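import Mathlib
import Summits.NavierStokesRegularity.NavierStokesRegularity.Theorems.EulerZoomLiouvillePowerGaugeEulerLiouvilleSelfSimilarHighSetFluxLateral
import Summits.NavierStokesRegularity.NavierStokesRegularity.Theorems.EulerZoomLiouvillePowerGaugeEulerLiouvilleSelfSimilarBernoulliSqueezePinchedMember
import HarnessLib

/-!
# «QUIET BANDS» at MEMBER level — the lateral exit law for the Bernoulli high sets of an in-class exactly self-similar member with `C²` profile
# (crux `EulerZoomLiouville.PowerGaugeEulerLiouville` = stmt-NavierStokesRegularity-19832, THE ONE STATEMENT `stub_selfSimilarC2Needle`, faces T2/T5;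
#  width seat ns-ezl-w1 g5)

Route №10 `EulerZoomLiouville` (NavierStokesRegularity).  The profile-level `HighSetFlux.quiet_band` with its two data hypotheses DISCHARGED from the crux
hypotheses exactly as in `…SelfSimilarHighSetFluxMember` (dictionary of ns-ezl-w5's `…SqueezePinchedMember`: `A`-growth of the profile + growth-free Sobolev
thinness `3+3ρ` of the far high sets):

* **`Past.quiet_band_of_past`** — a class member (`0 < ρ ≤ ½`, `γ = 1/(2+ρ)`) exactly self-similar about `(T, x₀)` for `τ < T₁` (`T₁ ≤ 0`, `T₁ ≤ T`) with a `C²`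
  profile `V`: for every classical pressure `P′` and level `h` there are `C ≥ 0`, `R₂ > 0` such that for every `η > 0`, every layer `0 < r ≤ R` and every
  `R' ≥ R₂` with `R'² ≤ R(R−r)`:  the band weight `S′((ℋ−h)/η)‖W‖²` is integrable on `{R ≤ |x|}` and
  `∫_{R ≤ |x|} S′((ℋ_{P′}−h)/η) ‖W‖² ≤ (η/(1−2γ)) · (3γ·C·R'^{−(3+3ρ)} + F_{R,r}(S((ℋ−h)/η)))`, `F_{R,r}(ω) = ∫ ω·(−Dθ_{R,r}[W])`;
* **`Loc.quiet_band_member`** — the origin-centred member (crux hypotheses verbatim).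

READING: the `‖W‖²`-mass of every Bernoulli level band `{h < ℋ < h+η}` beyond radius `R` — by coarea the average over the band of the `W`-flux through the level
surfaces `{ℋ = t}` — is `≲ η·(R'^{−3−3ρ} + net outflow flux of the high set through the layer)`; with the fat layer `r = R/2` the flux term tends to `0`
(`HighSetFlux.abs_flux_le`).  See `…HighSetFluxLateral` for the consistency check (the expansion `div W = 3γ` manufactures fed volume, so a jet seeded by an
exponentially small far flux satisfies the law: a portrait inequality, not a kill).
HONEST LABEL: tool at member level; nothing here excludes a needle.  WHAT THIS IS NOT: not NS, not E — `--supports` stmt-19832 on the MODEL lattice; 19832 OPEN;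
NS regularity NOT proved. [folklore; ConstantinIgnatovaVicol2026Putative §3.4.1 (3.22), §3.4.3 (3.31)/(3.33)]
-/

noncomputable section

-- flat `Theorems/<Route><Decl>…` files of one crux share the namespace of the crux (tree convention)
set_option linter.dupNamespace false

open MeasureTheory Set Filter Topology Metric Function InnerProductSpace
open scoped RealInnerProductSpace NNReal ENNReal

namespace Summit.NavierStokesRegularity.NavierStokesRegularity.Theorems.PowerGaugeEulerLiouville

open Literature.Analysis Literature.Analysis.FluidPDE Literature.Analysis.FunctionSpaces

namespace Past

variable {ρ T T₁ : ℝ} {x₀ : EuclideanSpace ℝ (Fin 3)}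
  {u : ℝ → EuclideanSpace ℝ (Fin 3) → EuclideanSpace ℝ (Fin 3)} {p : ℝ → EuclideanSpace ℝ (Fin 3) → ℝ}
  {H : ℝ → EuclideanSpace ℝ (Fin 3) → EuclideanSpace ℝ (Fin 3) →L[ℝ] EuclideanSpace ℝ (Fin 3)} {c : ℝ≥0}
  {V : EuclideanSpace ℝ (Fin 3) → EuclideanSpace ℝ (Fin 3)} {P : EuclideanSpace ℝ (Fin 3) → ℝ}

/-- **QUIET BANDS FOR A PAST-EXACT MEMBER WITH `C²` PROFILE** (`0 < ρ ≤ ½`; exact self-similarity about `(T, x₀)` for `τ < T₁`, `T₁ ≤ 0`, `T₁ ≤ T`;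
distributional solution + weak gradient + the three gauges): see the module docstring. [folklore; ConstantinIgnatovaVicol2026Putative §3.4.3 (3.31)] -/
theorem quiet_band_of_past (hρ : 0 < ρ) (hρh : ρ ≤ 1 / 2) (hT₁ : T₁ ≤ 0) (hTT₁ : T₁ ≤ T)
    (hsol : IsDistributionalNSSolutionOn (slab (EuclideanSpace ℝ (Fin 3)) (Iio 0) isOpen_Iio) 0 0 u p)
    (hH : HasWeakSpatialGradientOn (slab (EuclideanSpace ℝ (Fin 3)) (Iio 0) isOpen_Iio) u H)
    (hA : ∀ a : ℝ, 0 < a → ENNReal.ofReal (a ^ (2 * ρ)) *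
      cknA a (0 : ℝ × EuclideanSpace ℝ (Fin 3)) u ≤ (c : ℝ≥0∞))
    (hE : ∀ a : ℝ, 0 < a → ENNReal.ofReal (a ^ ρ) *
      cknE a (0 : ℝ × EuclideanSpace ℝ (Fin 3)) H ≤ (c : ℝ≥0∞))
    (hD : ∀ a : ℝ, 0 < a → ENNReal.ofReal (a ^ (2 * ρ)) *
      cknD a (0 : ℝ × EuclideanSpace ℝ (Fin 3)) p ≤ (c : ℝ≥0∞))
    (hu : ∀ τ : ℝ, τ < T₁ → u τ = fun x => selfSimilarCollapse (1 / (2 + ρ)) T V τ (x - x₀))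
    (hp : ∀ τ : ℝ, τ < T₁ → p τ = fun x => selfSimilarCollapsePressure (1 / (2 + ρ)) T P τ (x - x₀))
    (hV : ContDiff ℝ 2 V) {P' : EuclideanSpace ℝ (Fin 3) → ℝ} (hprof : IsSelfSimilarEulerProfile (1 / (2 + ρ)) 0 V P') (h : ℝ) :
    ∃ C R₂ : ℝ, 0 ≤ C ∧ 0 < R₂ ∧ ∀ η : ℝ, 0 < η → ∀ R r R' : ℝ, 0 < r → r ≤ R → R₂ ≤ R' → R' ^ 2 ≤ R * (R - r) →
      IntegrableOn (fun x => deriv Real.smoothTransition ((selfSimilarBernoulli (1 / (2 + ρ)) 0 V P' x - h) / η) *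
          ‖selfSimilarTransport (1 / (2 + ρ)) 0 V x‖ ^ 2) {x : EuclideanSpace ℝ (Fin 3) | R ≤ ‖x‖} ∧
      ∫ x in {x : EuclideanSpace ℝ (Fin 3) | R ≤ ‖x‖},
          deriv Real.smoothTransition ((selfSimilarBernoulli (1 / (2 + ρ)) 0 V P' x - h) / η) *
            ‖selfSimilarTransport (1 / (2 + ρ)) 0 V x‖ ^ 2 ≤
        η / (1 - 2 * (1 / (2 + ρ))) * (3 * (1 / (2 + ρ)) * C * R' ^ (-(3 + 3 * ρ)) +
          ∫ x, Real.smoothTransition ((selfSimilarBernoulli (1 / (2 + ρ)) 0 V P' x - h) / η) *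
            -(fderiv ℝ (taoCutoff R r) x (selfSimilarTransport (1 / (2 + ρ)) 0 V x))) := by
  -- the dictionary, adapted from `Past.bernoulli_flux_turning_law_of_past` (…HighSetFluxMember, this seat)
  have hρ1' : ρ < 1 := by linarith
  have h2ρ : (0 : ℝ) < 2 + ρ := by linarith
  have hγ : (0 : ℝ) < 1 / (2 + ρ) := one_div_pos.2 h2ρ
  have hγ2 : 1 / (2 + ρ) < 1 / 2 := one_div_lt_one_div_of_lt two_pos (by linarith)
  have h12 : 0 < 1 - 2 * (1 / (2 + ρ)) := by linarith
  have hext := Shifted.isDistributional_selfSimilarCollapse_of_past hT₁ hTT₁ x₀ hsol hu hp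
  have hpmE : AEStronglyMeasurable (uncurry (selfSimilarCollapsePressure (1 / (2 + ρ)) 0 P))
      (volume.restrict (Iio (0 : ℝ) ×ˢ (univ : Set (EuclideanSpace ℝ (Fin 3))))) := by
    have := hext.2.2.1.aestronglyMeasurable
    simpa [slab] using this
  have hPm : AEStronglyMeasurable P volume :=
    aestronglyMeasurable_pressureProfile (p := selfSimilarCollapsePressure (1 / (2 + ρ)) 0 P) hpmE fun _ _ => rfl
  have hP1 : LocallyIntegrable P volume :=
    Shifted.locallyIntegrable_pressureProfile_of_slab hγ.le (by linarith) hPm hext.2.2.1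
  obtain ⟨c₀, hc₀⟩ := WeakToClassical.pressureProfile_ae_eq_add_const hext (fun _ _ => rfl) (fun _ _ => rfl) hV hP1 hprof
  obtain ⟨CA, hCA, hgrowth⟩ := Shifted.profile_energy_growth_of_gaugeA_past hρ hρh hT₁ hTT₁ x₀ hu hA
  obtain ⟨cA, hcA, hA'⟩ := Loc.real_growth_of_growth_le hV.continuous (θ := 1 - 2 * ρ) (by linarith)
    (L₀ := 2 - T₁) (by linarith) hCA hgrowth
  have hV1 : ContDiff ℝ 1 V := hV.of_le (by norm_num)
  obtain ⟨CE, hCE, hEgr⟩ := NeedleRace.lintegral_fderiv_sq_ball_le_of_past hρ hρ1' hT₁ hTT₁ x₀ hH hu hE hV1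
  obtain ⟨cE, hcE, hE'⟩ := Loc.real_growth_of_growth_le (hV1.continuous_fderiv one_ne_zero) (θ := 1 - ρ) (by linarith)
    (L₀ := 2 - T₁) (by linarith) hCE hEgr
  have hpm : AEStronglyMeasurable (uncurry p)
      (volume.restrict (Iio (0 : ℝ) ×ˢ (univ : Set (EuclideanSpace ℝ (Fin 3))))) := by
    have := hsol.2.2.1.aestronglyMeasurable
    simpa [slab] using this
  obtain ⟨CD, hCD, hDgrowth⟩ := profile_pressure_growth_of_gaugeD_past hρ hρ1' hT₁ hTT₁ x₀ hpm hp hD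
  have hD' : ∀ L : ℝ, 2 - T₁ ≤ L → ∫⁻ y in ball (0 : EuclideanSpace ℝ (Fin 3)) L, ‖P y‖ₑ ^ (3 / 2 : ℝ) ≤
      (CD.toNNReal : ℝ≥0∞) * ENNReal.ofReal (L ^ (2 - 2 * ρ)) := by
    intro L hL; rw [ENNReal.coe_toNNReal hCD]; exact hDgrowth L hL
  obtain ⟨C', R₂, hR₂, hthin⟩ := Loc.volume_bernoulliHigh_inter_far_le_sobolev_free hρ hprof hcA hcE hA' hE' hPm hD' hc₀ h
  have hAcl : ∀ L : ℝ, 1 ≤ L → ∫ x in closedBall (0 : EuclideanSpace ℝ (Fin 3)) L, ‖V x‖ ^ 2 ≤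
      (2 : ℝ) ^ (1 - 2 * ρ) * cA * L ^ (1 - 2 * ρ) := fun L hL =>
    HighSetFlux.setIntegral_closedBall_sq_norm_le_of_gauge hV.continuous hcA hA' hL
  refine ⟨max C' 0, R₂, le_max_right _ _, hR₂, fun η hη R r R' hr hrR hR' hR'sq => ?_⟩
  have hR'0 : 0 < R' := hR₂.trans_le hR'
  have hsub : {x : EuclideanSpace ℝ (Fin 3) | h < selfSimilarBernoulli (1 / (2 + ρ)) 0 V P' x} ∩ {x | R * (R - r) ≤ ‖x‖ ^ 2} ⊆
      {x : EuclideanSpace ℝ (Fin 3) | h < selfSimilarBernoulli (1 / (2 + ρ)) 0 V P' x} ∩ {x | R' ≤ ‖x‖} := by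
    rintro x ⟨hx, hxR⟩
    refine ⟨hx, ?_⟩
    have h2 : R' ^ 2 ≤ ‖x‖ ^ 2 := hR'sq.trans hxR
    exact (pow_le_pow_iff_left₀ hR'0.le (norm_nonneg x) two_ne_zero).1 h2
  have hvol := (measure_mono hsub).trans (hthin R' hR')
  have hfin : volume ({x : EuclideanSpace ℝ (Fin 3) | h < selfSimilarBernoulli (1 / (2 + ρ)) 0 V P' x} ∩ {x | R * (R - r) ≤ ‖x‖ ^ 2}) < ∞ :=
    hvol.trans_lt ENNReal.ofReal_lt_top
  obtain ⟨hint, hle⟩ := HighSetFlux.quiet_band hprof hγ.le hγ2 (θA := 1 - 2 * ρ) (by linarith) hAcl h hη hr hrR hfin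
  refine ⟨hint, hle.trans ?_⟩
  have hvr : (volume ({x : EuclideanSpace ℝ (Fin 3) | h < selfSimilarBernoulli (1 / (2 + ρ)) 0 V P' x} ∩ {x | R * (R - r) ≤ ‖x‖ ^ 2})).toReal ≤
      max C' 0 * R' ^ (-(3 + 3 * ρ)) := by
    refine ENNReal.toReal_le_of_le_ofReal (by positivity) (hvol.trans (ENNReal.ofReal_le_ofReal ?_))
    exact mul_le_mul_of_nonneg_right (le_max_left _ _) (Real.rpow_nonneg hR'0.le _)
  refine mul_le_mul_of_nonneg_left ?_ (div_nonneg hη.le h12.le)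
  have h3 : 3 * (1 / (2 + ρ)) *
      (volume ({x : EuclideanSpace ℝ (Fin 3) | h < selfSimilarBernoulli (1 / (2 + ρ)) 0 V P' x} ∩ {x | R * (R - r) ≤ ‖x‖ ^ 2})).toReal ≤
      3 * (1 / (2 + ρ)) * (max C' 0 * R' ^ (-(3 + 3 * ρ))) := mul_le_mul_of_nonneg_left hvr (by positivity)
  linarith

end Past

/-! ### The origin-centred member -/

/-- **QUIET BANDS FOR AN EXACTLY SELF-SIMILAR MEMBER WITH `C²` PROFILE** (crux hypotheses verbatim, `0 < ρ ≤ ½`, `γ = 1/(2+ρ)`; exact self-similarity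
about the origin; `V ∈ C²`): for every classical pressure `P′` and level `h` there are `C ≥ 0`, `R₂ > 0` such that for all `η > 0`, `0 < r ≤ R`, `R₂ ≤ R'`,
`R'² ≤ R(R−r)`, the band weight `S′((ℋ−h)/η)‖W‖²` is integrable beyond `R` and
`∫_{R≤|x|} S′((ℋ−h)/η)‖W‖² ≤ (η/(1−2γ))·(3γ·C·R'^{−(3+3ρ)} + F_{R,r}(S((ℋ−h)/η)))`. [folklore; ConstantinIgnatovaVicol2026Putative §3.4.3 (3.31)] -/
theorem Loc.quiet_band_member {ρ : ℝ} (hρ : 0 < ρ) (hρ1 : ρ ≤ 1 / 2)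
    {u : ℝ → EuclideanSpace ℝ (Fin 3) → EuclideanSpace ℝ (Fin 3)} {p : ℝ → EuclideanSpace ℝ (Fin 3) → ℝ}
    {H : ℝ → EuclideanSpace ℝ (Fin 3) → EuclideanSpace ℝ (Fin 3) →L[ℝ] EuclideanSpace ℝ (Fin 3)} {c : ℝ≥0}
    (hsw : IsSuitableWeakSolutionOn (slab (EuclideanSpace ℝ (Fin 3)) (Iio 0) isOpen_Iio) 0 0 u p)
    (hH : HasWeakSpatialGradientOn (slab (EuclideanSpace ℝ (Fin 3)) (Iio 0) isOpen_Iio) u H)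
    (hgauge : ∀ a : ℝ, 0 < a →
      ENNReal.ofReal (a ^ (2 * ρ)) * cknA a (0 : ℝ × EuclideanSpace ℝ (Fin 3)) u +
          ENNReal.ofReal (a ^ ρ) * cknE a (0 : ℝ × EuclideanSpace ℝ (Fin 3)) H +
        ENNReal.ofReal (a ^ (2 * ρ)) * cknD a (0 : ℝ × EuclideanSpace ℝ (Fin 3)) p ≤ (c : ℝ≥0∞))
    {V : EuclideanSpace ℝ (Fin 3) → EuclideanSpace ℝ (Fin 3)} {P : EuclideanSpace ℝ (Fin 3) → ℝ}
    (hu : ∀ τ : ℝ, τ < 0 → u τ = selfSimilarCollapse (1 / (2 + ρ)) 0 V τ)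
    (hp : ∀ τ : ℝ, τ < 0 → p τ = selfSimilarCollapsePressure (1 / (2 + ρ)) 0 P τ)
    (hV : ContDiff ℝ 2 V) {P' : EuclideanSpace ℝ (Fin 3) → ℝ} (hprof : IsSelfSimilarEulerProfile (1 / (2 + ρ)) 0 V P') (h : ℝ) :
    ∃ C R₂ : ℝ, 0 ≤ C ∧ 0 < R₂ ∧ ∀ η : ℝ, 0 < η → ∀ R r R' : ℝ, 0 < r → r ≤ R → R₂ ≤ R' → R' ^ 2 ≤ R * (R - r) →
      IntegrableOn (fun x => deriv Real.smoothTransition ((selfSimilarBernoulli (1 / (2 + ρ)) 0 V P' x - h) / η) *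
          ‖selfSimilarTransport (1 / (2 + ρ)) 0 V x‖ ^ 2) {x : EuclideanSpace ℝ (Fin 3) | R ≤ ‖x‖} ∧
      ∫ x in {x : EuclideanSpace ℝ (Fin 3) | R ≤ ‖x‖},
          deriv Real.smoothTransition ((selfSimilarBernoulli (1 / (2 + ρ)) 0 V P' x - h) / η) *
            ‖selfSimilarTransport (1 / (2 + ρ)) 0 V x‖ ^ 2 ≤
        η / (1 - 2 * (1 / (2 + ρ))) * (3 * (1 / (2 + ρ)) * C * R' ^ (-(3 + 3 * ρ)) +
          ∫ x, Real.smoothTransition ((selfSimilarBernoulli (1 / (2 + ρ)) 0 V P' x - h) / η) *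
            -(fderiv ℝ (taoCutoff R r) x (selfSimilarTransport (1 / (2 + ρ)) 0 V x))) := by
  have hA : ∀ a : ℝ, 0 < a → ENNReal.ofReal (a ^ (2 * ρ)) *
      cknA a (0 : ℝ × EuclideanSpace ℝ (Fin 3)) u ≤ (c : ℝ≥0∞) :=
    fun a ha => le_trans (le_trans le_self_add le_self_add) (hgauge a ha)
  have hE : ∀ a : ℝ, 0 < a → ENNReal.ofReal (a ^ ρ) *
      cknE a (0 : ℝ × EuclideanSpace ℝ (Fin 3)) H ≤ (c : ℝ≥0∞) :=
    fun a ha => le_trans (le_trans le_add_self le_self_add) (hgauge a ha)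
  have hD : ∀ a : ℝ, 0 < a → ENNReal.ofReal (a ^ (2 * ρ)) *
      cknD a (0 : ℝ × EuclideanSpace ℝ (Fin 3)) p ≤ (c : ℝ≥0∞) :=
    fun a ha => le_trans le_add_self (hgauge a ha)
  have hu' : ∀ τ : ℝ, τ < 0 → u τ = fun x => selfSimilarCollapse (1 / (2 + ρ)) 0 V τ (x - 0) := fun τ hτ => by
    rw [hu τ hτ]; funext x; rw [sub_zero]
  have hp' : ∀ τ : ℝ, τ < 0 → p τ = fun x => selfSimilarCollapsePressure (1 / (2 + ρ)) 0 P τ (x - 0) := fun τ hτ => by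
    rw [hp τ hτ]; funext x; rw [sub_zero]
  exact Past.quiet_band_of_past hρ hρ1 le_rfl le_rfl hsw.distributional hH hA hE hD hu' hp' hV hprof h

end Summit.NavierStokesRegularity.NavierStokesRegularity.Theorems.PowerGaugeEulerLiouville

end
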